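import Mathlib.NumberTheory.NumberField.Completion.InfinitePlace
import Literature.NumberTheory.QuadraticForms.NormIndexSecondInequalityProofs
import Literature.NumberTheory.QuadraticForms.SUnitSquareIndexProofs
import Literature.NumberTheory.QuadraticForms.SquareClassIndex
import HarnessLib

/-!
# O'Meara 65:7 and 65:12: the idèle indices `(J_K^S : J_K^{S,2}) = 4^s` and
# `(J_K : P_K J_K^{S,2}) = 2^s`

Sibling proof file of `Literature.NumberTheory.QuadraticForms.SUnitSquareClasses` (namespace
`Literature.OMeara65`), all declarations fully proved. With `T ⊇` the dyadic places defining O'Meara's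
`S = {v ∉ T}`, `s = |T| + #InfinitePlace K`, `J^S = sIdeles K T`, `J^{S,2} = sSquareIdeles K T`,
`𝔲 = (↑T).unit K`, `P = principalIdeles K`:

* `relIndex_sSquareIdeles_sIdeles` — **65:7, first step**: the square-class map
  `J^S → ∏_{v ∈ T} K_vˣ/K_vˣ² × ∏_w K_wˣ/K_wˣ²` is onto with kernel `J^{S,2}`, so
  `(J^S : J^{S,2}) = ∏_{v ∈ T} (K_vˣ : K_vˣ²) · ∏_w (K_wˣ : K_wˣ²)`;
* `index_square_units_completion_of_isReal` / `_of_isComplex` — `(K_wˣ : K_wˣ²) = 2` resp. `1`;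
* `piQuotientTwo_surjective`, `ker_piQuotientTwo`, `natCard_piQuotientTwo`,
  `prod_natCard_integer_quotient_two` — **`∏_{v ∈ T} |𝒪_v / 2𝒪_v| = |𝓞 K / 2𝓞 K| = 2^{[K:ℚ]}`**
  (`𝓞 K → ∏_{v ∈ T} 𝒪_v/2𝒪_v` is onto by the density of `K` in `K_v` and the Chinese remainder
  theorem, with kernel `2𝓞 K`; `|𝓞 K/2𝓞 K| = |N_{K/ℚ} 2|`), O'Meara's `∏_{𝔭 dyadic} N𝔭^{ord_𝔭 2}`;
* `relIndex_sSquareIdeles_sIdeles_eq` — **65:7**: `(J^S : J^{S,2}) = 4^s`, using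
  `(K_vˣ : K_vˣ²) = 4 |𝒪_v/2𝒪_v|` at every finite place (O'Meara 63:9,
  `Literature.NumberTheory.QuadraticForms.index_square_eq_four_mul_natCard`, `SquareClassIndex.lean`) and `[K:ℚ] = r₁ + 2r₂`;
* `isSquare_of_isSquare_local_of_mem_unit` — **65:11** from the named facts 65:18, 65:18a
  (with generators of `𝔲 mod 𝔲²` from the proved 65:6): an `S`-unit that is a local square on
  `T ∪ ∞` is a square;
* `sSquareIdeles_inf_map_unit` — **65:11a**: `J^{S,2} ∩ ι(𝔲) = ι(𝔲²)` (`ι : Kˣ → 𝕀_K`);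
* `index_principalIdeles_sup_sSquareIdeles` — **65:12**: `(J : P J^{S,2}) = 2^s` under (iv)
  `J = P J^S`, by O'Meara's computation `(J : P J^{S,2}) = (J^S : J^{S,2}) ÷ (𝔲 : 𝔲 ∩ J^{S,2}) =
  4^s ÷ 2^s` (modular law, 65:11a, 65:6 = `sUnits_sq_relIndex_eq_holds`);
  `index_principalIdeles_sup_sSquareIdeles_eq_of_facts` discharges the named fact 65:12 of
  `SUnitSquareClasses.lean` relative to 65:18, 65:18a;
* `normIdeles_index_dvd_two_of_facts'` — the second inequality `normIdeles_index_dvd_two K` from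
  65:18 and 65:18a alone (via `NormIndexSecondInequalityProofs.lean`).

## References

* O. T. O'Meara, *Introduction to quadratic forms*, Grundlehren 117, Springer (1963), §65B
  (65:7, 65:11, 65:11a, 65:12), §63A (63:9).
-/

noncomputable section

open NumberField IsDedekindDomain
open scoped Valued

namespace Literature.NumberTheory.QuadraticForms.OMeara65

variable (K : Type) [Field K] [NumberField K]

/-! ### Square classes at the infinite places -/

section Archimedean

variable {K}

omit [NumberField K] in
/-- At a complex place every unit of `K_w ≅ ℂ` is a square: `(K_wˣ : K_wˣ²) = 1`.
[cite: Omeara1963, §65B Prop. 65:7 (proof, (3))] -/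
theorem index_square_units_completion_of_isComplex {w : InfinitePlace K} (hw : w.IsComplex) :
    (Subgroup.square (w.Completion)ˣ).index = 1 := by
  rw [Subgroup.index_eq_one, eq_top_iff]
  intro u _
  rw [Subgroup.mem_square]
  set ψ := InfinitePlace.Completion.ringEquivComplexOfIsComplex hw
  obtain ⟨z, hz⟩ := IsAlgClosed.exists_pow_nat_eq (ψ (u : w.Completion)) two_pos
  have hz0 : z ≠ 0 := by
    rintro rfl
    rw [zero_pow two_ne_zero, eq_comm, map_eq_zero] at hz
    exact u.ne_zero hz
  have hr0 : ψ.symm z ≠ 0 := by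
    intro h
    apply hz0
    simpa using congrArg ψ h
  refine ⟨Units.mk0 (ψ.symm z) hr0, Units.ext ?_⟩
  apply ψ.injective
  rw [Units.val_mul, Units.val_mk0, map_mul, RingEquiv.apply_symm_apply, ← hz, sq]

omit [NumberField K] in
/-- At a real place a unit of `K_w ≅ ℝ` is a square iff it is positive. [folklore] -/
theorem isSquare_units_completion_iff_pos {w : InfinitePlace K} (hw : w.IsReal)
    (u : (w.Completion)ˣ) :
    IsSquare u ↔ 0 < InfinitePlace.Completion.ringEquivRealOfIsReal hw (u : w.Completion) := by
  set ψ := InfinitePlace.Completion.ringEquivRealOfIsReal hw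
  constructor
  · rintro ⟨r, hr⟩
    have h : ψ (u : w.Completion) = ψ (r : w.Completion) ^ 2 := by
      rw [hr, Units.val_mul, map_mul, sq]
    rw [h]
    have hr0 : ψ (r : w.Completion) ≠ 0 := by
      rw [map_ne_zero_iff _ ψ.injective]; exact r.ne_zero
    positivity
  · intro hpos
    have hr0 : ψ.symm (Real.sqrt (ψ (u : w.Completion))) ≠ 0 := by
      intro h
      have := congrArg ψ h
      rw [RingEquiv.apply_symm_apply, map_zero, Real.sqrt_eq_zero'] at this
      linarith
    refine ⟨Units.mk0 _ hr0, Units.ext (ψ.injective ?_)⟩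
    rw [Units.val_mul, Units.val_mk0, map_mul, RingEquiv.apply_symm_apply,
      Real.mul_self_sqrt hpos.le]

omit [NumberField K] in
/-- At a real place the square classes of `K_w ≅ ℝ` are the two signs: `(K_wˣ : K_wˣ²) = 2`.
[cite: Omeara1963, §65B Prop. 65:7 (proof, (3))] -/
theorem index_square_units_completion_of_isReal {w : InfinitePlace K} (hw : w.IsReal) :
    (Subgroup.square (w.Completion)ˣ).index = 2 := by
  set ψ := InfinitePlace.Completion.ringEquivRealOfIsReal hw
  rw [Subgroup.index_eq_two_iff]
  refine ⟨-1, fun b ↦ ?_⟩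
  rw [Subgroup.mem_square, Subgroup.mem_square, isSquare_units_completion_iff_pos hw,
    isSquare_units_completion_iff_pos hw]
  have hb0 : ψ (b : w.Completion) ≠ 0 := by
    rw [map_ne_zero_iff _ ψ.injective]; exact b.ne_zero
  have hneg : ψ ((b * -1 : (w.Completion)ˣ) : w.Completion) = -ψ (b : w.Completion) := by
    rw [Units.val_mul, Units.val_neg, Units.val_one, mul_neg, mul_one, map_neg]
  rw [hneg]
  rcases lt_or_gt_of_ne hb0 with h | h
  · exact Or.inl ⟨by linarith, not_lt.2 h.le⟩
  · exact Or.inr ⟨h, not_lt.2 (by linarith)⟩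

end Archimedean

/-! ### O'Meara 65:7: `(J_K^S : J_K^{S,2})` is the product of the local square-class indices -/

section IdeleIndex

/-- The square-class map of `S`-idèles at the places of `T` and at infinity:
`i ↦ ((i_v mod K_vˣ²)_{v ∈ T}, (i_w mod K_wˣ²)_w)`, a surjection with kernel `J_K^{S,2}`; hence
**O'Meara 65:7 (first step)**: `(J_K^S : J_K^{S,2}) = ∏_{v ∈ T} (K_vˣ : K_vˣ²) · ∏_w (K_wˣ : K_wˣ²)`.
[cite: Omeara1963, §65B Prop. 65:7 (proof, (1))] -/
theorem relIndex_sSquareIdeles_sIdeles (T : Finset (HeightOneSpectrum (𝓞 K))) :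
    (sSquareIdeles K T).relIndex (sIdeles K T) =
      (∏ v ∈ T, (Subgroup.square (v.adicCompletion K)ˣ).index) *
        ∏ w : InfinitePlace K, (Subgroup.square (w.Completion)ˣ).index := by
  classical
  -- the square-class map
  let Qf : ↥T → Type := fun v ↦ (v.1.adicCompletion K)ˣ ⧸ Subgroup.square (v.1.adicCompletion K)ˣ
  let Qi : InfinitePlace K → Type := fun w ↦ (w.Completion)ˣ ⧸ Subgroup.square (w.Completion)ˣ
  let ψf : GaloisRepresentations.ideleGroup K →* (∀ v : ↥T, Qf v) :=
    MonoidHom.pi fun v : ↥T ↦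
      (QuotientGroup.mk' (Subgroup.square (v.1.adicCompletion K)ˣ)).comp
        (ideleFiniteComponent K v.1)
  let ψi : GaloisRepresentations.ideleGroup K →* (∀ w : InfinitePlace K, Qi w) :=
    MonoidHom.pi fun w : InfinitePlace K ↦
      (QuotientGroup.mk' (Subgroup.square (w.Completion)ˣ)).comp (ideleInfiniteComponent K w)
  let ψ : ↥(sIdeles K T) →* (∀ v : ↥T, Qf v) × (∀ w : InfinitePlace K, Qi w) :=
    (ψf.prod ψi).comp (sIdeles K T).subtype
  have hψ : ∀ (i : sIdeles K T),
      ψ i = (fun v : ↥T ↦ (QuotientGroup.mk (ideleFiniteComponent K v.1 (i : GaloisRepresentations.ideleGroup K)) : Qf v),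
        fun w ↦ (QuotientGroup.mk (ideleInfiniteComponent K w (i : GaloisRepresentations.ideleGroup K)) : Qi w)) :=
    fun _ ↦ rfl
  -- kernel
  have hker : ψ.ker = (sSquareIdeles K T).subgroupOf (sIdeles K T) := by
    ext ⟨i, hi⟩
    rw [MonoidHom.mem_ker, Subgroup.mem_subgroupOf, hψ, Prod.mk_eq_one, funext_iff, funext_iff]
    simp only [Pi.one_apply, QuotientGroup.eq_one_iff, Subgroup.mem_square]
    rw [mem_sSquareIdeles_iff]
    constructor
    · rintro ⟨hf, hinf⟩
      exact ⟨hi, fun v hv ↦ hf ⟨v, hv⟩, hinf⟩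
    · rintro ⟨-, hf, hinf⟩
      exact ⟨fun v ↦ hf v.1 v.2, hinf⟩
  -- surjectivity
  have hsurj : Function.Surjective ψ := by
    rintro ⟨qf, qi⟩
    have hf : ∀ v : ↥T, ∃ t : (v.1.adicCompletion K)ˣ, (QuotientGroup.mk t : Qf v) = qf v :=
      fun v ↦ QuotientGroup.mk_surjective (qf v)
    have hi' : ∀ w : InfinitePlace K, ∃ s : (w.Completion)ˣ, (QuotientGroup.mk s : Qi w) = qi w :=
      fun w ↦ QuotientGroup.mk_surjective (qi w)
    choose t ht using hf
    choose s hs using hi'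
    let t' : ∀ v : HeightOneSpectrum (𝓞 K), (v.adicCompletion K)ˣ := fun v ↦
      if hv : v ∈ T then t ⟨v, hv⟩ else 1
    have hmem : ideleOf K T t' s ∈ sIdeles K T := fun v hv ↦ by
      rw [ideleFiniteComponent_ideleOf_of_not_mem K t' s hv, Units.val_one, map_one]
    refine ⟨⟨ideleOf K T t' s, hmem⟩, ?_⟩
    rw [hψ]
    refine Prod.ext (funext fun v ↦ ?_) (funext fun w ↦ ?_)
    · simp only
      rw [ideleFiniteComponent_ideleOf_of_mem K t' s v.2, ← ht v]
      simp only [t', dif_pos v.2]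
    · simp only
      rw [ideleInfiniteComponent_ideleOf, hs w]
  -- count
  rw [Subgroup.relIndex, ← hker, Subgroup.index_ker, MonoidHom.range_eq_top.2 hsurj,
    Subgroup.card_top, Nat.card_prod, Nat.card_pi, Nat.card_pi]
  congr 1
  rw [← Finset.prod_coe_sort T]
  exact Finset.prod_congr rfl fun v _ ↦ (Subgroup.index_eq_card _).symm

end IdeleIndex

/-! ### The dyadic count `∏_{v ∣ 2} |𝒪_v / 2𝒪_v| = 2^{[K:ℚ]}` -/

section DyadicCount

/-- At a place `v` not above `2`, `𝒪_v / 2𝒪_v` is trivial. [folklore] -/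
theorem natCard_integer_quotient_two_of_not_mem (v : HeightOneSpectrum (𝓞 K))
    (h2 : (2 : 𝓞 K) ∉ v.asIdeal) :
    Nat.card (𝒪[v.adicCompletion K] ⧸ Ideal.span {(2 : 𝒪[v.adicCompletion K])}) = 1 := by
  have h : Ideal.span {(2 : 𝒪[v.adicCompletion K])} = ⊤ :=
    Ideal.span_singleton_eq_top.2 (isUnit_two_integer_of_not_mem K v h2)
  rw [h]
  haveI : Subsingleton (𝒪[v.adicCompletion K] ⧸ (⊤ : Ideal 𝒪[v.adicCompletion K])) :=
    Ideal.Quotient.subsingleton_iff.2 rfl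
  exact Nat.card_of_subsingleton (0 : 𝒪[v.adicCompletion K] ⧸ (⊤ : Ideal _))

/-- Membership in `2𝒪_v` is a valuation inequality: `z ∈ 2𝒪_v ↔ v(z) ≤ v(2)`. [folklore] -/
theorem mem_span_two_integer_iff (v : HeightOneSpectrum (𝓞 K)) (z : 𝒪[v.adicCompletion K]) :
    z ∈ Ideal.span {(2 : 𝒪[v.adicCompletion K])} ↔
      Valued.v (z : v.adicCompletion K) ≤ Valued.v (2 : v.adicCompletion K) := by
  haveI : CharZero (v.adicCompletion K) :=
    charZero_of_injective_algebraMap (algebraMap K _).injective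
  have h20 : (2 : v.adicCompletion K) ≠ 0 := two_ne_zero
  rw [Ideal.mem_span_singleton']
  constructor
  · rintro ⟨a, rfl⟩
    rw [Subring.coe_mul]  -- hmm: valuation subring coe
    change Valued.v ((a : v.adicCompletion K) * 2) ≤ _
    rw [map_mul]
    exact mul_le_of_le_one_left' a.2
  · intro h
    have hq : Valued.v ((z : v.adicCompletion K) / 2) ≤ 1 := by
      rw [map_div₀]
      exact div_le_one_of_le₀ h zero_le
    refine ⟨⟨(z : v.adicCompletion K) / 2, hq⟩, Subtype.ext ?_⟩
    change (z : v.adicCompletion K) / 2 * 2 = z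
    rw [div_mul_cancel₀ _ h20]

/-- **`𝓞 K → ∏_{v ∈ D} 𝒪_v / 2𝒪_v` is onto** for any finite set `D` of finite places (density
of `𝓞 K` in each `𝒪_v`, Mathlib `exists_valuation_sub_lt_of_integer`, and the Chinese remainder
theorem `IsDedekindDomain.exists_forall_sub_mem_ideal`). [folklore] -/
theorem piQuotientTwo_surjective (D : Finset (HeightOneSpectrum (𝓞 K))) :
    Function.Surjective (RingHom.pi fun v : ↥D ↦
      (Ideal.Quotient.mk (Ideal.span {(2 : 𝒪[v.1.adicCompletion K])})).comp
        (algebraMap (𝓞 K) (v.1.adicCompletionIntegers K) :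
          𝓞 K →+* 𝒪[v.1.adicCompletion K])) := by
  classical
  intro q
  -- representatives `z v ∈ 𝒪_v`
  have hz : ∀ v : ↥D, ∃ z : 𝒪[v.1.adicCompletion K], Ideal.Quotient.mk _ z = q v :=
    fun v ↦ Ideal.Quotient.mk_surjective (q v)
  choose z hz using hz
  have hval : ∀ (v : HeightOneSpectrum (𝓞 K)) (c : K),
      Valued.v (algebraMap K (v.adicCompletion K) c) = v.valuation K c :=
    fun v c ↦ HeightOneSpectrum.valuedAdicCompletion_eq_valuation' v c
  -- Step 1: `a v ∈ 𝓞 K` with `v(a v - z v) ≤ v(2)` (density)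
  have h2ne : ∀ v : HeightOneSpectrum (𝓞 K), Valued.v (2 : v.adicCompletion K) ≠ 0 := by
    intro v
    haveI : CharZero (v.adicCompletion K) :=
      charZero_of_injective_algebraMap (algebraMap K _).injective
    exact (Valuation.ne_zero_iff _).2 two_ne_zero
  have hstep1 : ∀ v : ↥D, ∃ a : 𝓞 K,
      Valued.v (algebraMap K (v.1.adicCompletion K) (a : K) - (z v : v.1.adicCompletion K)) ≤
        Valued.v (2 : v.1.adicCompletion K) := by
    intro v
    haveI : CharZero (v.1.adicCompletion K) :=
      charZero_of_injective_algebraMap (algebraMap K _).injective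
    set γ : (WithZero (Multiplicative ℤ))ˣ := Units.mk0 _ (h2ne v.1) with hγ
    -- `k ∈ K` close to `z v` (density of `K` in `K_v`)
    have hnhds : {y : v.1.adicCompletion K | Valued.v (y - (z v : v.1.adicCompletion K)) <
        Valued.v (2 : v.1.adicCompletion K)} ∈ nhds (z v : v.1.adicCompletion K) := by
      rw [Valued.mem_nhds]
      have h' : Valued.v.restrict (2 : v.1.adicCompletion K) ≠ 0 := by simp
      refine ⟨Units.mk0 _ h', fun y hy ↦ ?_⟩
      rw [Set.mem_setOf_eq, Units.val_mk0] at hy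
      exact Valued.v.restrict_lt_iff.mp hy
    obtain ⟨_, ⟨hk, ⟨k, rfl⟩⟩⟩ := mem_closure_iff_nhds.mp
      (HeightOneSpectrum.denseRange_algebraMap (K := K) v.1 (z v : v.1.adicCompletion K)) _ hnhds
    rw [Set.mem_setOf_eq] at hk
    have hγ1 : Valued.v (2 : v.1.adicCompletion K) ≤ 1 := (2 : 𝒪[v.1.adicCompletion K]).2
    have hk1 : v.1.valuation K k ≤ 1 := by
      rw [← hval]
      have hx : Valued.v (z v : v.1.adicCompletion K) ≤ 1 := (z v).2
      have := Valuation.map_add Valued.v (algebraMap K (v.1.adicCompletion K) k - z v)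
        (z v : v.1.adicCompletion K)
      rw [sub_add_cancel] at this
      exact this.trans (max_le (hk.le.trans hγ1) hx)
    obtain ⟨a, ha⟩ := v.1.exists_valuation_sub_lt_of_integer hk1 γ
    refine ⟨a, ?_⟩
    have h2 : Valued.v (algebraMap K (v.1.adicCompletion K) (a : K) -
        algebraMap K (v.1.adicCompletion K) k) < γ := by
      rw [← map_sub, hval]; exact ha
    rw [hγ, Units.val_mk0] at h2
    have := Valuation.map_add_lt Valued.v h2 hk
    rw [sub_add_sub_cancel] at this
    exact this.le
  choose a ha using hstep1
  -- Step 2: CRT in `𝓞 K`: `y ≡ a v (mod v^{e v})` with `v(2) = exp(-e v)`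
  let e : HeightOneSpectrum (𝓞 K) → ℕ := fun v ↦ (-WithZero.log (v.intValuation (2 : 𝓞 K))).toNat
  have he : ∀ v : HeightOneSpectrum (𝓞 K), v.intValuation (2 : 𝓞 K) = WithZero.exp (-(e v : ℤ)) := by
    intro v
    have h0 : v.intValuation (2 : 𝓞 K) ≠ 0 := by
      exact HeightOneSpectrum.intValuation_ne_zero v 2 two_ne_zero
    have h1 : v.intValuation (2 : 𝓞 K) ≤ 1 := HeightOneSpectrum.intValuation_le_one v 2
    rw [← WithZero.exp_log h0] at h1 ⊢
    rw [← WithZero.exp_zero, WithZero.exp_le_exp] at h1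
    congr 1
    simp only [e]
    omega
  obtain ⟨y, hy⟩ := IsDedekindDomain.exists_forall_sub_mem_ideal (s := D)
    (fun v : HeightOneSpectrum (𝓞 K) ↦ v.asIdeal) e (fun v _ ↦ v.prime)
    (fun v _ w _ hvw ↦ fun h ↦ hvw (HeightOneSpectrum.ext h)) (fun v ↦ a v)
  refine ⟨y, funext fun v ↦ ?_⟩
  rw [RingHom.pi_apply, RingHom.comp_apply, ← hz v, Ideal.Quotient.eq, mem_span_two_integer_iff]
  -- `v(y - z v) ≤ v(2)`
  have hy' : Valued.v (algebraMap K (v.1.adicCompletion K) ((y : K) - (a v : K))) ≤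
      Valued.v (2 : v.1.adicCompletion K) := by
    rw [hval, ← map_sub, HeightOneSpectrum.valuation_of_algebraMap]
    have h := (HeightOneSpectrum.intValuation_le_pow_iff_mem v.1 (y - a v) (e v.1)).2 (hy v.1 v.2)
    rw [← he] at h
    have h2K : Valued.v (2 : v.1.adicCompletion K) = v.1.intValuation (2 : 𝓞 K) := by
      have h2 : algebraMap K (v.1.adicCompletion K) ((2 : 𝓞 K) : K) = 2 := by
        rw [show ((2 : 𝓞 K) : K) = 2 from rfl, map_ofNat]
      rw [← h2, hval, HeightOneSpectrum.valuation_of_algebraMap]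
    rw [h2K]
    exact h
  have key : ∀ w : 𝒪[v.1.adicCompletion K],
      (w : v.1.adicCompletion K) = algebraMap K (v.1.adicCompletion K) (y : K) →
      Valued.v ((w - z v : 𝒪[v.1.adicCompletion K]) : v.1.adicCompletion K) ≤
        Valued.v (2 : v.1.adicCompletion K) := by
    intro w hw
    have hcoe : ((w - z v : 𝒪[v.1.adicCompletion K]) : v.1.adicCompletion K) =
        (w : v.1.adicCompletion K) - (z v : v.1.adicCompletion K) := rfl
    have hsplit : algebraMap K (v.1.adicCompletion K) (y : K) - (z v : v.1.adicCompletion K) =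
        algebraMap K (v.1.adicCompletion K) ((y : K) - (a v : K)) +
          (algebraMap K (v.1.adicCompletion K) (a v : K) - (z v : v.1.adicCompletion K)) := by
      rw [map_sub]; ring
    rw [hcoe, hw, hsplit]
    exact (Valuation.map_add Valued.v _ _).trans (max_le hy' (ha v))
  exact key _ rfl

/-- The kernel of `𝓞 K → ∏_{v ∈ D} 𝒪_v / 2𝒪_v` is `2𝓞 K` as soon as `D` contains the dyadic
places (an element of `K` which is integral at every place is in `𝓞 K`, applied to `x/2`).
[folklore] -/
theorem ker_piQuotientTwo (D : Finset (HeightOneSpectrum (𝓞 K)))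
    (hD : ∀ v : HeightOneSpectrum (𝓞 K), (2 : 𝓞 K) ∈ v.asIdeal → v ∈ D) :
    RingHom.ker (RingHom.pi fun v : ↥D ↦
      (Ideal.Quotient.mk (Ideal.span {(2 : 𝒪[v.1.adicCompletion K])})).comp
        (algebraMap (𝓞 K) (v.1.adicCompletionIntegers K) :
          𝓞 K →+* 𝒪[v.1.adicCompletion K])) = Ideal.span {(2 : 𝓞 K)} := by
  classical
  have hval : ∀ (v : HeightOneSpectrum (𝓞 K)) (c : K),
      Valued.v (algebraMap K (v.adicCompletion K) c) = v.valuation K c :=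
    fun v c ↦ HeightOneSpectrum.valuedAdicCompletion_eq_valuation' v c
  have h2K : ∀ v : HeightOneSpectrum (𝓞 K),
      algebraMap K (v.adicCompletion K) ((2 : 𝓞 K) : K) = 2 := fun v ↦ by
    rw [show ((2 : 𝓞 K) : K) = 2 from rfl, map_ofNat]
  apply le_antisymm
  · intro x hx
    rw [RingHom.mem_ker, funext_iff] at hx
    -- `x / 2` is integral at every place
    have h20 : ((2 : 𝓞 K) : K) ≠ 0 := by
      rw [show ((2 : 𝓞 K) : K) = 2 from rfl]; exact two_ne_zero
    have hint : ∀ v : HeightOneSpectrum (𝓞 K), v.valuation K ((x : K) / ((2 : 𝓞 K) : K)) ≤ 1 := by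
      intro v
      rw [map_div₀]
      by_cases hv : v ∈ D
      · have h := hx ⟨v, hv⟩
        rw [RingHom.pi_apply, Pi.zero_apply, RingHom.comp_apply, Ideal.Quotient.eq_zero_iff_mem,
          mem_span_two_integer_iff] at h
        change Valued.v (algebraMap K (v.adicCompletion K) (x : K)) ≤ _ at h
        rw [hval, ← h2K v, hval] at h
        have h2pos : 0 < v.valuation K ((2 : 𝓞 K) : K) := by
          rw [zero_lt_iff, Valuation.ne_zero_iff]; exact h20
        exact div_le_one_of_le₀ h zero_le
      · have h2 : (2 : 𝓞 K) ∉ v.asIdeal := fun h ↦ hv (hD v h)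
        have h2v : v.valuation K ((2 : 𝓞 K) : K) = 1 :=
          (HeightOneSpectrum.valuation_eq_one_iff_notMem v).2 h2  -- name?
        rw [h2v, div_one]
        exact HeightOneSpectrum.valuation_le_one v x
    obtain ⟨r, hr⟩ := HeightOneSpectrum.mem_integers_of_valuation_le_one K _ hint
    rw [Ideal.mem_span_singleton']
    refine ⟨r, ?_⟩
    apply IsFractionRing.injective (𝓞 K) K
    rw [map_mul]
    change algebraMap (𝓞 K) K r * ((2 : 𝓞 K) : K) = (x : K)
    rw [hr, div_mul_cancel₀ _ h20]
  · rw [Ideal.span_le, Set.singleton_subset_iff, SetLike.mem_coe, RingHom.mem_ker]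
    funext v
    rw [RingHom.pi_apply, Pi.zero_apply, RingHom.comp_apply, Ideal.Quotient.eq_zero_iff_mem,
      Ideal.mem_span_singleton']
    refine ⟨1, Subtype.ext ?_⟩
    change (1 : v.1.adicCompletion K) * 2 = algebraMap K (v.1.adicCompletion K) ((2 : 𝓞 K) : K)
    rw [h2K, one_mul]

/-- **`|𝓞 K / 2𝓞 K| = ∏_{v ∈ D} |𝒪_v / 2𝒪_v| = 2^{[K:ℚ]}`** for any finite set `D` of finite
places containing the dyadic ones (Chinese remainder theorem and completion; the cardinality
of `𝓞 K / 2 𝓞 K` is `|N_{K/ℚ}(2)| = 2^{[K:ℚ]}`, Mathlib `Ideal.absNorm_span_singleton`).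
[cite: Omeara1963, §65B Prop. 65:7 (proof, (3))] -/
theorem natCard_piQuotientTwo (D : Finset (HeightOneSpectrum (𝓞 K)))
    (hD : ∀ v : HeightOneSpectrum (𝓞 K), (2 : 𝓞 K) ∈ v.asIdeal → v ∈ D) :
    Nat.card (∀ v : ↥D, 𝒪[v.1.adicCompletion K] ⧸ Ideal.span {(2 : 𝒪[v.1.adicCompletion K])}) =
      2 ^ Module.finrank ℚ K := by
  classical
  set ρ := (RingHom.pi fun v : ↥D ↦
      (Ideal.Quotient.mk (Ideal.span {(2 : 𝒪[v.1.adicCompletion K])})).comp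
        (algebraMap (𝓞 K) (v.1.adicCompletionIntegers K) :
          𝓞 K →+* 𝒪[v.1.adicCompletion K])) with hρ
  have e := RingHom.quotientKerEquivOfSurjective (piQuotientTwo_surjective K D)
  rw [← Nat.card_congr e.toEquiv, ker_piQuotientTwo K D hD, ← Submodule.cardQuot_apply,
    ← Ideal.absNorm_apply, Ideal.absNorm_span_singleton,
    show (2 : 𝓞 K) = algebraMap ℤ (𝓞 K) 2 from by simp, Algebra.norm_algebraMap,
    NumberField.RingOfIntegers.rank]
  simp [Int.natAbs_pow]

/-- **O'Meara 65:7, the dyadic factor**: for `T ⊇` the dyadic places,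
`∏_{v ∈ T} |𝒪_v / 2𝒪_v| = 2^{[K:ℚ]}` (`= ∏_{𝔭 dyadic} N𝔭^{ord_𝔭 2}`, the non-dyadic factors
being `1`). [cite: Omeara1963, §65B Prop. 65:7 (proof, (3))] -/
theorem prod_natCard_integer_quotient_two {T : Finset (HeightOneSpectrum (𝓞 K))}
    (hT : ContainsDyadic K T) :
    ∏ v ∈ T, Nat.card (𝒪[v.adicCompletion K] ⧸ Ideal.span {(2 : 𝒪[v.adicCompletion K])}) =
      2 ^ Module.finrank ℚ K := by
  rw [← natCard_piQuotientTwo K T hT, Nat.card_pi, ← Finset.prod_coe_sort T]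

end DyadicCount

/-! ### O'Meara 65:7: `(J_K^S : J_K^{S,2}) = 4^s` -/

section SixtyFiveSeven

/-- The archimedean factor: `∏_w (K_wˣ : K_wˣ²) = 2^{r₁}`. [cite: Omeara1963, §65B Prop. 65:7
(proof, (3))] -/
theorem prod_index_square_units_completion :
    ∏ w : InfinitePlace K, (Subgroup.square (w.Completion)ˣ).index =
      2 ^ InfinitePlace.nrRealPlaces K := by
  classical
  have h : ∀ w : InfinitePlace K, (Subgroup.square (w.Completion)ˣ).index =
      if w.IsReal then 2 else 1 := by
    intro w
    split_ifs with hw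
    · exact index_square_units_completion_of_isReal hw
    · exact index_square_units_completion_of_isComplex
        (InfinitePlace.not_isReal_iff_isComplex.1 hw)
  simp_rw [h]
  rw [Finset.prod_ite, Finset.prod_const, Finset.prod_const_one, mul_one,
    InfinitePlace.nrRealPlaces, Fintype.card_subtype]

/-- **O'Meara 65:7**: for `T` containing the dyadic places, `(J_K^S : J_K^{S,2}) = 4^s`,
`s = |T| + #InfinitePlace K`: the product over `v ∈ T` of `(K_vˣ : K_vˣ²) = 4 |𝒪_v/2𝒪_v|`
(63:9, `index_square_eq_four_mul_natCard` of `SquareClassIndex.lean`), over the real places of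
`2` and over the complex places of `1`, evaluated with `∏_{v ∈ T} |𝒪_v/2𝒪_v| = 2^{[K:ℚ]}` and
`[K:ℚ] = r₁ + 2 r₂`. [cite: Omeara1963, §65B Prop. 65:7] -/
theorem relIndex_sSquareIdeles_sIdeles_eq {T : Finset (HeightOneSpectrum (𝓞 K))}
    (hT : ContainsDyadic K T) :
    (sSquareIdeles K T).relIndex (sIdeles K T) = 4 ^ sCard K T := by
  classical
  rw [relIndex_sSquareIdeles_sIdeles, prod_index_square_units_completion]
  have hfin : ∏ v ∈ T, (Subgroup.square (v.adicCompletion K)ˣ).index =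
      4 ^ T.card * 2 ^ Module.finrank ℚ K := by
    rw [← prod_natCard_integer_quotient_two K hT, ← Finset.prod_const, ← Finset.prod_mul_distrib]
    exact Finset.prod_congr rfl fun v _ ↦ index_square_eq_four_mul_natCard K v
  rw [hfin, sCard_eq, ← InfinitePlace.card_add_two_mul_card_eq_rank,
    InfinitePlace.card_eq_nrRealPlaces_add_nrComplexPlaces]
  have h4 : (4 : ℕ) = 2 ^ 2 := by norm_num
  rw [h4, ← pow_mul, ← pow_mul, mul_assoc, ← pow_add, ← pow_add]
  congr 1
  ring

end SixtyFiveSeven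

/-! ### O'Meara 65:11a and 65:12 from 65:18, 65:18a (and the proved 65:6, 65:7) -/

section SixtyFiveTwelve

/-- The principal `S`-idèles `P_K ∩ J_K^S` are the principal idèles of the `S`-units:
`principalIdeles K ⊓ sIdeles K T = ι(𝔲)`, `ι : Kˣ → 𝕀_K`. [cite: Omeara1963, §33I and §65A] -/
theorem principalIdeles_inf_sIdeles (T : Finset (HeightOneSpectrum (𝓞 K))) :
    GaloisRepresentations.principalIdeles K ⊓ sIdeles K T =
      (((↑T : Set (HeightOneSpectrum (𝓞 K))).unit K).map
        (Units.map (algebraMap K (AdeleRing (𝓞 K) K) : K →* AdeleRing (𝓞 K) K))) := by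
  ext x
  rw [Subgroup.mem_inf, Subgroup.mem_map]
  constructor
  · rintro ⟨⟨α, rfl⟩, hx⟩
    refine ⟨α, fun v hv ↦ ?_, rfl⟩
    have h := hx v hv
    rw [ideleFiniteComponent_principal, Units.coe_map, MonoidHom.coe_coe,
      GaloisRepresentations.valued_algebraMap_adicCompletion] at h
    exact h
  · rintro ⟨α, hα, rfl⟩
    refine ⟨⟨α, rfl⟩, fun v hv ↦ ?_⟩
    rw [ideleFiniteComponent_principal, Units.coe_map, MonoidHom.coe_coe,
      GaloisRepresentations.valued_algebraMap_adicCompletion]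
    exact hα v hv

/-- The diagonal embedding `ι : Kˣ → 𝕀_K` is injective. [folklore] -/
theorem unitsMap_algebraMap_adeleRing_injective :
    Function.Injective
      (Units.map (algebraMap K (AdeleRing (𝓞 K) K) : K →* AdeleRing (𝓞 K) K)) := by
  intro a b hab
  have h := congrArg (fun z : GaloisRepresentations.ideleGroup K ↦ (z : AdeleRing (𝓞 K) K)) hab
  simp only [Units.coe_map, MonoidHom.coe_coe] at h
  exact Units.ext (NumberField.AdeleRing.algebraMap_injective (𝓞 K) K h)

/-- In `ℤᵐ⁰`, `x * x = 1` forces `x = 1`. [folklore] -/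
theorem WithZeroMulInt.eq_one_of_mul_self {x : WithZero (Multiplicative ℤ)} (h : x * x = 1) :
    x = 1 := by
  have hx : x ≠ 0 := by
    rintro rfl
    rw [mul_zero] at h
    exact zero_ne_one h
  have h2 := congrArg WithZero.log h
  rw [WithZero.log_mul hx hx, WithZero.log_one] at h2
  rw [← WithZero.exp_log hx, show WithZero.log x = 0 by omega, WithZero.exp_zero]

/-- **O'Meara 65:11 from 65:18 and 65:18a**: under the conventions of §65A, an `S`-unit `α`
that is a square at all spots of `Ω - S` (in `K_v` for `v ∈ T` and in every `K_w`) is a square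
in `K` — 65:18a with the `s` spots of 65:18 attached to any generators of `𝔲 mod 𝔲²` (which
exist by 65:6 and linear algebra over `𝔽₂`). O'Meara obtains 65:11 directly from the unit index
65:10 (and notes that it "can be obtained from Corollary 65:18a").
[cite: Omeara1963, §65B Prop. 65:11] -/
theorem isSquare_of_isSquare_local_of_mem_unit (h18 : exists_places_generators_nonsquare K)
    (h18a : isSquare_of_generators_places K) {T : Finset (HeightOneSpectrum (𝓞 K))}
    (hT : ContainsDyadic K T) (hadm : IsAdmissible K T) {α : Kˣ}
    (hαu : α ∈ ((↑T : Set (HeightOneSpectrum (𝓞 K))).unit K))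
    (hαT : ∀ v ∈ T, IsSquare (algebraMap K (v.adicCompletion K) (α : K)))
    (hαinf : ∀ w : InfinitePlace K, IsSquare (algebraMap K w.Completion (α : K))) :
    IsSquare (α : K) := by
  classical
  set u : Subgroup Kˣ := (↑T : Set (HeightOneSpectrum (𝓞 K))).unit K with hu
  -- a non-square `θ ∈ 𝔲` (since `(𝔲 : 𝔲²) = 2^s ≥ 2`) and generators containing it
  have h6 : (u.map (powMonoidHom 2)).relIndex u = 2 ^ sCard K T :=
    sUnits_sq_relIndex_eq_holds K T hT hadm
  have hθ : ∃ θ : Kˣ, θ ∈ u ∧ θ ∉ u.map (powMonoidHom 2) := by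
    by_contra hall
    push Not at hall
    have hle : u ≤ u.map (powMonoidHom 2) := fun x hx ↦ hall x hx
    have h1 : (u.map (powMonoidHom 2)).relIndex u = 1 := Subgroup.relIndex_eq_one.2 hle
    rw [h1] at h6
    have hs := one_le_sCard K T
    have : (2 : ℕ) ^ sCard K T ≥ 2 ^ 1 := Nat.pow_le_pow_right two_pos hs
    omega
  obtain ⟨θ, hθu, hθ2⟩ := hθ
  obtain ⟨ι, _, ε, i₀, hcard, -, hgen⟩ := exists_isGeneratorsModSq_of_relIndex u h6 hθu hθ2
  obtain ⟨p, hpT, hp⟩ := h18 T hT hadm ι hcard ε hgen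
  exact h18a T hT hadm ι hcard ε hgen p hpT hp α hαT hαinf fun v hv _ ↦ hαu v hv

/-- **O'Meara 65:11a from 65:18 and 65:18a**: `P_F^S ∩ J_F^{S,2} = (P_F^S)²` — a principal
`S`-idèle which is a local square at all spots of `Ω - S` is the principal idèle of the square
of an `S`-unit. Here: `sSquareIdeles K T ⊓ ι(𝔲) = ι(𝔲²)`.
[cite: Omeara1963, §65B Cor. 65:11a] -/
theorem sSquareIdeles_inf_map_unit (h18 : exists_places_generators_nonsquare K)
    (h18a : isSquare_of_generators_places K) {T : Finset (HeightOneSpectrum (𝓞 K))}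
    (hT : ContainsDyadic K T) (hadm : IsAdmissible K T) :
    sSquareIdeles K T ⊓
        ((↑T : Set (HeightOneSpectrum (𝓞 K))).unit K).map
          (Units.map (algebraMap K (AdeleRing (𝓞 K) K) : K →* AdeleRing (𝓞 K) K)) =
      (((↑T : Set (HeightOneSpectrum (𝓞 K))).unit K).map (powMonoidHom 2)).map
        (Units.map (algebraMap K (AdeleRing (𝓞 K) K) : K →* AdeleRing (𝓞 K) K)) := by
  classical
  set u : Subgroup Kˣ := (↑T : Set (HeightOneSpectrum (𝓞 K))).unit K with hu
  set ι : Kˣ →* GaloisRepresentations.ideleGroup K :=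
    Units.map (algebraMap K (AdeleRing (𝓞 K) K) : K →* AdeleRing (𝓞 K) K) with hι
  ext x
  simp only [Subgroup.mem_inf, Subgroup.mem_map, powMonoidHom_apply]
  constructor
  · rintro ⟨hxC, α, hαu, rfl⟩
    obtain ⟨-, hsqT, hsqinf⟩ := hxC
    have hαT : ∀ v ∈ T, IsSquare (algebraMap K (v.adicCompletion K) (α : K)) := fun v hv ↦ by
      have h := hsqT v hv
      rw [hι, ideleFiniteComponent_principal] at h
      exact h.map (Units.coeHom _)
    have hαinf : ∀ w : InfinitePlace K, IsSquare (algebraMap K w.Completion (α : K)) := fun w ↦ by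
      have h := hsqinf w
      rw [hι, ideleInfiniteComponent_principal] at h
      exact h.map (Units.coeHom _)
    obtain ⟨β, hβ⟩ := isSquare_of_isSquare_local_of_mem_unit K h18 h18a hT hadm hαu hαT hαinf
    have hβ0 : β ≠ 0 := by
      rintro rfl
      exact α.ne_zero (by rw [hβ, mul_zero])
    have hαβ : α = Units.mk0 β hβ0 ^ 2 := Units.ext (by rw [Units.val_pow_eq_pow_val, Units.val_mk0, hβ, sq])
    have hβu : Units.mk0 β hβ0 ∈ u := fun v hv ↦ by
      have h := hαu v hv
      rw [hαβ, Units.val_pow_eq_pow_val, map_pow, sq] at h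
      exact WithZeroMulInt.eq_one_of_mul_self h
    exact ⟨Units.mk0 β hβ0 ^ 2, ⟨Units.mk0 β hβ0, hβu, rfl⟩, by rw [hαβ]⟩
  · rintro ⟨_, ⟨δ, hδu, rfl⟩, rfl⟩
    refine ⟨⟨fun v hv ↦ ?_, fun v _ ↦ ?_, fun w ↦ ?_⟩, δ ^ 2, u.pow_mem hδu 2, rfl⟩
    · rw [hι, ideleFiniteComponent_principal, Units.coe_map, MonoidHom.coe_coe,
        GaloisRepresentations.valued_algebraMap_adicCompletion, Units.val_pow_eq_pow_val, map_pow, hδu v hv, one_pow]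
    · rw [map_pow]
      exact ⟨ι δ |> ideleFiniteComponent K v, by rw [sq, map_mul]⟩
    · rw [map_pow]
      exact ⟨ι δ |> ideleInfiniteComponent K w, by rw [sq, map_mul]⟩

/-- The modular law for the tower `J^{S,2} ≤ J^S`: `(P ⊔ J^{S,2}) ⊓ J^S = (P ⊓ J^S) ⊔ J^{S,2}`.
[folklore] -/
theorem principalIdeles_sup_sSquareIdeles_inf_sIdeles (T : Finset (HeightOneSpectrum (𝓞 K))) :
    (GaloisRepresentations.principalIdeles K ⊔ sSquareIdeles K T) ⊓ sIdeles K T =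
      (GaloisRepresentations.principalIdeles K ⊓ sIdeles K T) ⊔ sSquareIdeles K T := by
  apply le_antisymm
  · rintro x ⟨hx, hxB⟩
    obtain ⟨p, hp, c, hc, rfl⟩ := Subgroup.mem_sup.1 hx
    have hpB : p ∈ sIdeles K T := by
      have : p = p * c * c⁻¹ := by rw [mul_inv_cancel_right]
      rw [this]
      exact (sIdeles K T).mul_mem hxB ((sIdeles K T).inv_mem (sSquareIdeles_le_sIdeles K T hc))
    exact Subgroup.mem_sup.2 ⟨p, ⟨hp, hpB⟩, c, hc, rfl⟩
  · exact sup_le (fun x hx ↦ ⟨Subgroup.mem_sup_left hx.1, hx.2⟩)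
      (fun x hx ↦ ⟨Subgroup.mem_sup_right hx, sSquareIdeles_le_sIdeles K T hx⟩)

/-- **O'Meara 65:12 from 65:18 and 65:18a** (with the proved 65:6 and 65:7): under the
conventions of §65A, `(J_K : P_K J_K^{S,2}) = 2^s`. O'Meara's computation:
`(J_F : P_F J_F^{S,2}) = (J_F^S : P_F^S J_F^{S,2}) = (J_F^S : J_F^{S,2}) ÷ (P_F^S : P_F^S ∩ J_F^{S,2})
= 4^s ÷ (P_F^S : (P_F^S)²) = 4^s ÷ 2^s` (65:7, 65:11a, 65:6).
[cite: Omeara1963, §65B Prop. 65:12] -/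
theorem index_principalIdeles_sup_sSquareIdeles (h18 : exists_places_generators_nonsquare K)
    (h18a : isSquare_of_generators_places K) {T : Finset (HeightOneSpectrum (𝓞 K))}
    (hT : ContainsDyadic K T) (hadm : IsAdmissible K T) :
    (GaloisRepresentations.principalIdeles K ⊔ sSquareIdeles K T).index = 2 ^ sCard K T := by
  classical
  set P := GaloisRepresentations.principalIdeles K with hP
  set B := sIdeles K T with hB
  set C := sSquareIdeles K T with hC
  set u : Subgroup Kˣ := (↑T : Set (HeightOneSpectrum (𝓞 K))).unit K with hu
  set ι : Kˣ →* GaloisRepresentations.ideleGroup K :=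
    Units.map (algebraMap K (AdeleRing (𝓞 K) K) : K →* AdeleRing (𝓞 K) K) with hι
  have hCB : C ≤ B := sSquareIdeles_le_sIdeles K T
  have htop : P ⊔ B = ⊤ := hadm
  -- (i) `(J : P ⊔ C) = ((P ⊓ B) ⊔ C : B)`-relative index
  have h1 : (P ⊔ C).index = ((P ⊓ B) ⊔ C).relIndex B := by
    rw [← Subgroup.relIndex_top_right, ← htop]
    have hsup : P ⊔ B = (P ⊔ C) ⊔ B := by
      apply le_antisymm
      · exact sup_le (le_sup_left.trans le_sup_left) le_sup_right
      · exact sup_le (sup_le le_sup_left (hCB.trans le_sup_right)) le_sup_right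
    rw [hsup, Subgroup.relIndex_sup_left, ← Subgroup.inf_relIndex_right,
      principalIdeles_sup_sSquareIdeles_inf_sIdeles]
  -- (ii) `(B : C) = (P ⊓ B : C ⊓ (P ⊓ B)) · ((P ⊓ B) ⊔ C : B)`
  have h2 : C.relIndex B = (C ⊓ (P ⊓ B)).relIndex (P ⊓ B) * ((P ⊓ B) ⊔ C).relIndex B := by
    rw [← Subgroup.relIndex_mul_relIndex C ((P ⊓ B) ⊔ C) B le_sup_right
      (sup_le inf_le_right hCB), Subgroup.relIndex_sup_right, Subgroup.inf_relIndex_right]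
  -- (iii) `(P ⊓ B : C ⊓ (P ⊓ B)) = (𝔲 : 𝔲²) = 2^s` (65:11a, 65:6)
  have h3 : (C ⊓ (P ⊓ B)).relIndex (P ⊓ B) = 2 ^ sCard K T := by
    rw [hP, hB, principalIdeles_inf_sIdeles, hC, sSquareIdeles_inf_map_unit K h18 h18a hT hadm,
      Subgroup.relIndex_map_map_of_injective _ _ (unitsMap_algebraMap_adeleRing_injective K)]
    exact sUnits_sq_relIndex_eq_holds K T hT hadm
  -- (iv) `(B : C) = 4^s` (65:7)
  have h4 : C.relIndex B = 4 ^ sCard K T := relIndex_sSquareIdeles_sIdeles_eq K hT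
  rw [h1]
  rw [h3, h4, show (4 : ℕ) = 2 * 2 by norm_num, mul_pow] at h2
  exact (Nat.eq_of_mul_eq_mul_left (by positivity) h2).symm

/-- **O'Meara 65:12 holds, given 65:18 and 65:18a**: the named fact
`index_principalIdeles_sup_sSquareIdeles_eq K` of `SUnitSquareClasses.lean` follows from
`exists_places_generators_nonsquare K` and `isSquare_of_generators_places K` (everything else in
O'Meara's computation — 65:6, 65:7 with 63:9, 65:11a — being proved).
[cite: Omeara1963, §65B Prop. 65:12] -/
theorem index_principalIdeles_sup_sSquareIdeles_eq_of_facts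
    (h18 : exists_places_generators_nonsquare K) (h18a : isSquare_of_generators_places K) :
    index_principalIdeles_sup_sSquareIdeles_eq K := fun _ hT hadm ↦
  index_principalIdeles_sup_sSquareIdeles K h18 h18a hT hadm

/-- **The second inequality from 65:18 and 65:18a alone**: `normIdeles_index_dvd_two K`
(`(J_K : P_K N_{E/K} J_E) ∣ 2` for every `E = K(√a)`) follows from the two remaining named facts
of O'Meara's §65, `exists_places_generators_nonsquare K` (65:18) and
`isSquare_of_generators_places K` (65:18a) — 65:6, 65:7, 65:11a, 65:12 and the tower argument of
65:21 being proved (`SUnitSquareIndexProofs`, this file, `NormIndexSecondInequalityProofs`).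
[cite: Omeara1963, §65D Prop. 65:21 (proof)] -/
theorem normIdeles_index_dvd_two_of_facts' (h18 : exists_places_generators_nonsquare K)
    (h18a : isSquare_of_generators_places K) : normIdeles_index_dvd_two K :=
  normIdeles_index_dvd_two_of_facts K (sUnits_sq_relIndex_eq_holds K)
    (index_principalIdeles_sup_sSquareIdeles_eq_of_facts K h18 h18a) h18 h18a

end SixtyFiveTwelve

end Literature.NumberTheory.QuadraticForms.OMeara65
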